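import Summits.HodgeConjecture.HodgeConjecture.Theorems.F0P3SpectralPacketXiSigned            -- ★ (N) FILE 3q (this seat): `XiPacketsSigned`, `piXiS`, `trSψ_piXiS_eq` (+ ★ 3f `trSψ`, `transportAPackets`)
import Summits.HodgeConjecture.HodgeConjecture.Theorems.F0P3bLocalExpansionAtKitOfRecord     -- ★ (F0P3b desk): `GTraceProductForm` (+ ★ K0 `F0P3KitOfRecord`: `GHSide`, `XiSide`, `cptXi₀`; ★ `archPacketOfRecord`, `nCompactOfRecord`)
import Summits.HodgeConjecture.HodgeConjecture.Theorems.F0P3GHSideOfFibres                   -- ★ p01 (g8∕g9): `ghOfFibres` (+ `ghOfFibres_matchesS_iff`, `ghOfFibres_TestSG`)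
import HarnessLib

/-!
# (N) DEFS, FILE 3q′ — (P3′)-G OF LETTER K9-STF BY NAME: `GTraceProductForm` AT `ghOfFibres … (trGS := trSψ) …` FROM THE SIGNED ξ-PACKET SHAPE (Rogawski §13.2 p. 200 l. 1–3; §14.4 Prop. 14.4.1 (a)
# p. 235; §14.6 p. 243, p. 244 ll. 6–17)

Cell `hodgecm-mathlib` (D-0151), F0∕P3 «U3-mult», crux H413 (`stmt-HodgeConjecture-24833`), route of record `HCCMUnconditional`.  (N) lead pen F0P3a-p01 (g13); census
`F0/P3a/F0P3a-p01/g13/CENSUS-N-FILE3q-P3primeG-at-tuple.F0P3a-p01g13.md` d70a21bb (q7); LEAD F0P3a-plan (g10); desk F0P3-plan (g9) («K9STF ⟸ TUPLE»).  PROOF LANE: one theorem,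
0 definitions, no instance, no notation, no named fact, no `sorry`; `--supports stmt-HodgeConjecture-24833 --as helper`.
HONEST LABEL: HC_CM is proved only modulo the printed citations until rung 0 closes; this file proves no printed statement — it discharges the clause (P3′)-G of letter K9-STF
(`K9SpectralLetterSigned`, `Cruxes/H413/Lines/F0_U3LettersRung1Defs.lean` :1477–:1483) AT THE (N) TUPLE, BY NAME, from the signed letter shape ★ FILE 3q `XiPacketsSigned` (junction input
`hXiS`), the member-admissibility kit law, and three junction identifications.

WHAT IS PROVED.  With the letter's own `gh := ghOfFibres ι T hT 𝔰 hg hsm trGS trHS` at the socket tuple `𝔰 := ⟨traceGp, Smooth, SpectralPacketG 𝔩 𝔞 μ, PH, nG, nH, trG, trH, Matches⟩` and the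
(N) slot `trGS S Q f′_S := Q.trSψ ψ S (ψ_* νG) archTr f′_S` (★ FILE 3f; BOARD §B2), the clause
`GTraceProductForm ι T hT gh ξd μω jInf dsInf archTr νG` («`Tr Π(ξ)_S(f_{S,G}) = [cptXi₀ ξ] · (−1)^N · (A πⁿ_ι − A πˢ_ι) · ∏_{v ∈ S} (Tr πⁿ_v − Tr πˢ_v)(f′_v)` under `MatchesS`», ★
`F0P3bLocalExpansionAtKitOfRecord`) HOLDS as soon as the ξ-side `ξd` reads `PiXi := piXiS hXiS` and `packFin := Pk′` (the `G′`-side A-packet record, transported to the kit's frame by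
★ `transportAPackets ψ Pk′`), the archimedean A-packets are `archPacketOfRecord ι μω jInf dsInf`, and the signed shape's scalar is `κ ξ = (−1)^N · [cptXi₀ ι μω ξ]` (as a complex number).
No `ram ξ ⊆ S` is used (the identity is place-wise); `archTr` is a parameter (junction: `archTr₀ L ι H T hT νGi`).

References: [Rogawski1990] §13.2 p. 200 l. 1–3; §13.1 Prop. 13.1.3 (b)(d) p. 199; §12.3 Prop. 12.3.3 p. 178; §14.4 Prop. 14.4.1 (a) p. 235; §14.6 p. 243, p. 244 ll. 6–17; §14.2 pp. 232–233.
-/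

set_option autoImplicit false
-- the mandated namespace repeats `HodgeConjecture.HodgeConjecture`, as in every `Theorems/*.lean` of this sub-problem
set_option linter.dupNamespace false

noncomputable section

open NumberField IsDedekindDomain MeasureTheory
open scoped Matrix MatrixGroups

open Literature.NumberTheory Literature.NumberTheory.Automorphic Literature.NumberTheory.Automorphic.UnitaryGroup
open Literature.NumberTheory.Rogawski1990 Literature.NumberTheory.GaloisRepresentations
open Literature.RepresentationTheory.BorelWallach2000 Literature.RepresentationTheory.KonnoKonno2007
open Summit.HodgeConjecture.HodgeConjecture.Cruxes.H413.F0P3InnerFormClassificationV6 (Gp Places Sockets TestGp TestG TestH splitForm)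
open Summit.HodgeConjecture.HodgeConjecture.Cruxes.H413.F0P3InnerFormClassificationV6.ClassificationKit (memberCoeff)
open Summit.HodgeConjecture.HodgeConjecture.Cruxes.H413.F0P3LocalPacketKit
open Summit.HodgeConjecture.HodgeConjecture.Cruxes.H413.F0P3ArchPacketKit
open Summit.HodgeConjecture.HodgeConjecture.Cruxes.H413.F0P3SemilocalTestFunctionsOfRecord (TestS₀ tens₀)
open Summit.HodgeConjecture.HodgeConjecture.Cruxes.H413.F0P3TestFunctionsOfRecord (Unr₀)
open Summit.HodgeConjecture.HodgeConjecture.Cruxes.H413.F0P3KitOfRecord (GHSide XiSide cptXi₀)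
open Summit.HodgeConjecture.HodgeConjecture.Cruxes.H413.F0P3XiArchDataOfRecord (nCompactOfRecord)
open Summit.HodgeConjecture.HodgeConjecture.Cruxes.H413.F0P3XiArchPacketOfRecord (archPacketOfRecord)
open Summit.HodgeConjecture.HodgeConjecture.Cruxes.H413.F0P3GHSideOfFibres (ghOfFibres)
open Summit.HodgeConjecture.HodgeConjecture.Cruxes.H413.F0P3bLocalExpansionAtKitOfRecord (GTraceProductForm)

namespace Summit.HodgeConjecture.HodgeConjecture.Cruxes.H413.F0P3SpectralPacket.SpectralPacketG

open Summit.HodgeConjecture.HodgeConjecture.Cruxes.H413.F0P3GlobalPacket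

variable {L : Type} [Field L] [NumberField L] [IsCMField L] {H : Matrix (Fin 3) (Fin 3) L} {ι : L →+* ℂ} {T : GL (Fin 3) ℂ}
  {hT : (T : Matrix (Fin 3) (Fin 3) ℂ)ᴴ * H.map ι * (T : Matrix (Fin 3) (Fin 3) ℂ) = Literature.Geometry.ComplexHyperbolic.BallModel.J}
  {𝔩 : ∀ v : HeightOneSpectrum (𝓞 ↥(maximalRealSubfield L)), LocalPacketKit L (splitForm L 3) v} {𝔞 : ArchPacketKit}
  {μ : Measure (adelicGroupData (↥(maximalRealSubfield L)) L (IsCMField.complexConj L) 3 (splitForm L 3)).automorphicQuotient}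
  [SMulInvariantMeasure (adelicGroupData (↥(maximalRealSubfield L)) L (IsCMField.complexConj L) 3 (splitForm L 3)).Adelic
    (adelicGroupData (↥(maximalRealSubfield L)) L (IsCMField.complexConj L) 3 (splitForm L 3)).automorphicQuotient μ]
  [∀ v : HeightOneSpectrum (𝓞 ↥(maximalRealSubfield L)), MeasurableSpace ((cmDatum L 3 (splitForm L 3)).Local v)]
  [∀ v : HeightOneSpectrum (𝓞 ↥(maximalRealSubfield L)), BorelSpace ((cmDatum L 3 (splitForm L 3)).Local v)]
  -- the `G′`-side sockets other than `PacketG` (the letter's `𝔰 := ⟨𝔨.traceGp, 𝔨.Smooth, PG, PH, nG, nH, trG, trH, 𝔨.Matches⟩`)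
  {μGp : Measure (Gp L H).automorphicQuotient} [(Gp L H).IsAutomorphicMeasure μGp]
  {traceGp : TestGp L H →ₗ[ℂ] ℂ} {Smooth : TestGp L H → Prop} {PH : Type} {nG : SpectralPacketG 𝔩 𝔞 μ → ℂ} {nH : PH → ℂ}
  {trG : SpectralPacketG 𝔩 𝔞 μ → TestG L → ℂ} {trH : PH → TestH L → ℂ} {Matches : TestGp L H → TestG L → TestH L → Prop}
  {Pk' : OneDimAutRepH L → ∀ v : HeightOneSpectrum (𝓞 ↥(maximalRealSubfield L)), CMLocalAPacket L H v} {κ : OneDimAutRepH L → ℤ}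

open scoped Classical in
/-- **(q7) (P3′)-G OF LETTER K9-STF AT THE TUPLE, BY NAME.**  For the letter's `gh := ghOfFibres ι T hT 𝔰 hg hsm trGS trHS` with the (N) slot `trGS S Q f′_S := Q.trSψ ψ S (ψ_* νG) archTr f′_S`,
a ξ-side `ξd` reading `PiXi := piXiS hXiS` and `packFin := Pk′`, archimedean A-packets `archPacketOfRecord ι μω jInf dsInf`, and the signed scalar `κ ξ = (−1)^N · [cptXi₀ ι μω ξ]`:
`GTraceProductForm ι T hT gh ξd μω jInf dsInf archTr νG` — «`Tr Π(ξ)_S(f_{S,G}) = [cptXi₀ ξ] · (−1)^N · (A πⁿ_ι − A πˢ_ι) · ∏_{v ∈ S} (Tr πⁿ_v − Tr πˢ_v)(f′_v)`» [13.1.3 (b); 12.3.3 (b); Prop. 14.4.1 (a);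
p. 244 ll. 6–17] — modulo ONE kit law (member admissibility of `Π(ξ)_v`, `hadm`).  Proof: `MatchesS ↔ fSG = fS` (★ `ghOfFibres`), then ★ FILE 3q `trSψ_piXiS_eq`.
[cite: Rogawski1990, §13.2 p. 200 l. 1–3; §13.1 Prop. 13.1.3 (b)(d) p. 199; §12.3 Prop. 12.3.3 p. 178; §14.4 Prop. 14.4.1 (a) p. 235; §14.6 p. 243, p. 244 ll. 6–17] -/
theorem gTraceProductForm_ghOfFibres_of_xiPacketsSigned
    (ψ : ∀ v : HeightOneSpectrum (𝓞 ↥(maximalRealSubfield L)), (cmDatum L 3 H).Local v ≃ₜ* (cmDatum L 3 (splitForm L 3)).Local v)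
    (νG : ∀ v : HeightOneSpectrum (𝓞 ↥(maximalRealSubfield L)), @Measure ((cmDatum L 3 H).Local v) (borel _))
    (hνl : ∀ v : HeightOneSpectrum (𝓞 ↥(maximalRealSubfield L)), letI : MeasurableSpace ((cmDatum L 3 H).Local v) := borel _; (νG v).IsMulLeftInvariant)
    (hνc : ∀ v : HeightOneSpectrum (𝓞 ↥(maximalRealSubfield L)), letI : MeasurableSpace ((cmDatum L 3 H).Local v) := borel _; IsFiniteMeasureOnCompacts (νG v))
    (μω : HeckeCharacter L) (jInf dsInf : ℤ → ℤ → ℤ → GKIrrClass (uFormGroup (Fin 2) (Fin 1)))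
    (archTr : GKIrrClass (uFormGroup (Fin 2) (Fin 1)) → (UnitaryGroup.arch (↥(maximalRealSubfield L)) L (IsCMField.complexConj L) 3 H → ℂ) → ℂ)
    (hXiS : XiPacketsSigned 𝔩 𝔞 μ (transportAPackets ψ Pk') (archPacketOfRecord ι μω jInf dsInf) κ)
    (hadm : ∀ (ξ : OneDimAutRepH L) (v : HeightOneSpectrum (𝓞 ↥(maximalRealSubfield L))), ∀ π ∈ (𝔩 v).mem ((piXiS hXiS ξ).fin.loc v), π.IsAdmissible)
    (hκ : ∀ ξ : OneDimAutRepH L, (κ ξ : ℂ) = (if cptXi₀ ι μω ξ then 1 else 0) * (-1) ^ nCompactOfRecord L)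
    (hg : ∀ f' : TestGp L H, Smooth f' → ∃ (f : TestG L) (fH : TestH L), Matches f' f fH)
    (hsm : ∀ (S : Finset (Places L)) (fS : TestS₀ L H ι T hT S) (fT : Unr₀ L H S), Smooth (tens₀ S fS fT))
    (trHS : ∀ S : Finset (Places L), PH → TestS₀ L H ι T hT S → ℂ)
    (ξd : XiSide L H (SpectralPacketG 𝔩 𝔞 μ) PH) (hPi : ∀ ξ : OneDimAutRepH L, ξd.PiXi ξ = piXiS hXiS ξ)
    (hPk : ∀ (ξ : OneDimAutRepH L) (v : HeightOneSpectrum (𝓞 ↥(maximalRealSubfield L))), ξd.packFin ξ v = Pk' ξ v) :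
    GTraceProductForm ι T hT
      (ghOfFibres ι T hT (⟨traceGp, Smooth, SpectralPacketG 𝔩 𝔞 μ, PH, nG, nH, trG, trH, Matches⟩ : Sockets L H μGp) hg hsm
        (fun S Q fS => Q.trSψ ψ S (fun v => @Measure.map _ _ (borel _) _ (ψ v) (νG v)) archTr fS) trHS)
      ξd μω jInf dsInf archTr νG := by
  letI : ∀ v : HeightOneSpectrum (𝓞 ↥(maximalRealSubfield L)), MeasurableSpace ((cmDatum L 3 H).Local v) := fun _ => borel _
  haveI : ∀ v : HeightOneSpectrum (𝓞 ↥(maximalRealSubfield L)), BorelSpace ((cmDatum L 3 H).Local v) := fun _ => ⟨rfl⟩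
  haveI : ∀ v : HeightOneSpectrum (𝓞 ↥(maximalRealSubfield L)), (νG v).IsMulLeftInvariant := hνl
  haveI : ∀ v : HeightOneSpectrum (𝓞 ↥(maximalRealSubfield L)), IsFiniteMeasureOnCompacts (νG v) := hνc
  intro ξ S _ fS fSG fSH hm
  obtain ⟨hfS, -⟩ := hm
  rw [hfS]
  change (ξd.PiXi ξ).trSψ ψ S (fun v => @Measure.map _ _ (borel _) _ (ψ v) (νG v)) archTr fS = _
  rw [hPi ξ, trSψ_piXiS_eq ψ hXiS ξ (hadm ξ) S fS archTr, hκ ξ]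
  simp only [hPk ξ, mul_assoc]

end Summit.HodgeConjecture.HodgeConjecture.Cruxes.H413.F0P3SpectralPacket.SpectralPacketG

end
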